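import Literature.MathematicalPhysics.QuantumFieldTheory.Balaban1983to89.B15Ineq148Proof

/-!
# `Balaban1983to89.B15Claim129Step` — [Balaban1989LargeFieldI] pp. 186–187: the INDUCTIVE STEP of the proof of (1.29)
# for the function `χ_k^{(n)}` — *"Now consider the conditions in the definition (1.24) of χ_k^{(n)} … Thus taking α = 1/8
# in (1.48) we satisfy all the conditions. We have proved that the function χ_k^{(n)} in (1.29) is equal to 1."* —
# ASSEMBLED over abstract plaquette families from the tree's kernel-checked line steps (b01 `sf149_step`, r12
# `sf151_step`) plus the one sub-case the printed text leaves implicit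

statement-level skeleton of published theorems with citation tags; proofs where landed; nothing here is a claim about
the Yang–Mills mass gap.

CITATION HEADER (lean-in-tree rule 2026-08-18).  T. Bałaban, *Large field renormalization. I. The basic step of the 𝐑
operation*, Commun. Math. Phys. **122**, 175–202 (1989), doi:10.1007/BF01257412, bib `Balaban1989LargeFieldI` (cell
paper B15; PDF held `paper:balaban1989-cmp122-large-field-i`, journal page = PDF page + 174; pp. 181–182, 186–187 READ
AS IMAGES on the x2 renders `run/shared/lean/pub/pub-balaban/b2b-balaban-ref1/pages/1989-cmp122-large-field-I/
…-p007,p008,p012,p013-x2.png`).  WHAT IS REPRODUCED: SKELETON rows `B15.Eq1.29` (its proof step for `χ_k^{(n)}`),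
`B15.Eq1.49`–`B15.Eq1.52`, unit `lit-balaban-r12` gen 8 (reader/typer and fold owner of block B15, Phase 2 in own block),
HOME `run/shared/lean/pub/lit-balaban/` (`lit-balaban-r12/ROWS-B15.md`).  Used BY NAME, nothing restated: the typed
lines `B15.BasicStep.SF149` ∕ `SF151`, (1.48) `B15.BasicStep.Ineq148`, the (1.49)-step `B15.BasicStep.sf149_step`
((1.48) + (1.49)ₙ₊₁ ⇒ (1.50) ⇒ (1.49)ₙ, *"if 8α ≦ 1"*), the (1.51)-step `B15Ineq148Proof.sf151_step` ((1.48) at `i = j`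
+ (1.51)ₙ₊₁ ⇒ (1.52) ⇒ (1.51)ₙ), the schematic claim `B15.BasicStep.Claim129`.

THE PRINTED TEXT (pp. 186–187, verbatim).  *"Now consider the conditions in the definition (1.24) of χ_k^{(n)}. The
condition on the domain Z″_{i+1}∖Z″_i, for i = h, h + 1, …, j − 1, can be written in the form |U^{(n)}_{k,Z}(∂p) − 1| <
(1 − β(1 − 2^{−(j−i+1)}))L₀^{2max{0,i−k₀−1}}ε_i(L^{k−i}η)². (1.49) The corresponding condition for the configuration
U^{(n+1)}_{k,Z} is of the same form, only j is replaced by j + 1. Introducing this bound into (1.48) we obtain [(1.50)],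
and the last inequality implies (1.49) if 8α ≦ 1. On the domain Ω_l∖Ω_{l+1}, for l = k₀ + 1, …, j, and on the domain
Ω^c_{k₀+1}∖Z″_j for l = k₀, the condition on the configuration U^{(n)}_{k,Z} is |U^{(n)}_{k,Z}(∂p) − 1| <
(1 − β½)L₀^{2max{0,j−l−1}}ε_j(L^{k−j}η)². (1.51) The condition on the configuration U^{(n+1)}_{k,Z} has the same form,
only j is replaced by j + 1. Introducing this bound into the inequality (1.48), which holds on those domains with i = j, we
obtain [(1.52)]. The above inequality implies (1.51), under the usual restrictions on β₀, β, L₀ (i.e., β₀ ≦ 1/2, β ≦ 1/2,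
L₀ < (1/2)L), and α ≦ 1/4. Thus taking α = 1/8 in (1.48) we satisfy all the conditions. We have proved that the function
χ_k^{(n)} in (1.29) is equal to 1. This completes the proof of the equality (1.29)."*

WHAT IS PROVED (0 `sorry`, no `def`, no new `Prop`).  With `s_i = 2^{−(j−i)} = (1/2)^{j−i}`, `Q_i = L₀^{2max{0,i−k₀−1}} =
(L₀²)^{i−k₀−1}` (natural subtraction), `E_i = ε_i(L^{k−i}η)²`, `W = (L^{k−j}η)²` (so `E_j = ε_jW`, `E_{j+1} = ε_{j+1}W/L²`):
* `sf151_of_149_step` — the ONE SUB-CASE THE TEXT LEAVES IMPLICIT: the part `Z″_{j+1}∖Z″_j` of the level-`n` domain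
  `Ω^c_{k₀+1}∖Z″_j` carries at level `n + 1` the (1.49)-bound with `i = j` (threshold `(1 − β(1 − 2^{−2}))Q_jE_j`, NOT a
  (1.51)-bound in `ε_{j+1}`-units); with the same (1.48) at `i = j` one still gets the level-`n` (1.51)-line there:
  `(1 − ¾β)(1 + αβ)Q + αβ ≦ (1 − ½β)Q` for `α ≦ 1/8`, `Q ≧ 1`, `0 ≦ β ≦ 1` (located completion; nothing in print fails).
* `lines124_step` — **the inductive step for `χ_k^{(n)}` assembled**: for abstract plaquette families `SZ i` (`h ≦ i < j`:
  `Z″_{i+1}∖Z″_i`), `SΩ l` (`k₀ ≦ l ≦ j`: `Ω_l∖Ω_{l+1}`, resp. `Ω^c_{k₀+1}∖Z″_{j+1}` for `l = k₀`) and `Sjj` (the part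
  `Z″_{j+1}∖Z″_j` of `Ω^c_{k₀+1}∖Z″_j`), the level-`(n+1)` lines of (1.24) for `U^{(n+1)}_{k,Z}` (deviations `dev′`) together
  with (1.48) on each domain (gap `j − i`, resp. `i = j`) give ALL the level-`n` lines of (1.24) for `U^{(n)}_{k,Z}`
  (deviations `dev`), under the printed restrictions `β₀ ≦ 1/2`, `β ≦ 1/2`, `L₀ < (1/2)L`, `α ≦ 1/8` (and `L₀ ≧ 1`, the flow
  input `ε_{j+1} ≦ (1 + β₀)ε_j` of [III] §2 used by (1.52), signs).
* `claim129_step_of_chain` — hence `B15.BasicStep.Claim129 new old` with `old` := «all level-`n` lines hold» as soon as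
  the new restrictions imply the level-`(n+1)` lines and the (1.48)-bounds (hypothesis `hchain` — the content of
  (1.44)–(1.48), i.e. `B15Ineq148Proof.ineq148_of_146_147` over the leaves (1.45)–(1.47)).
HONEST SCOPE.  Real bookkeeping over abstract index families; the geometry (which plaquettes lie in which domain, the
points `y ∈ Γ″_i` of (1.46)) and the analytic leaves (1.45)–(1.47) are hypotheses of the inputs, untouched.  The other
factors of (1.29) — the functions (1.3), (1.4) (`B15SmallField185.sf13_of_131`), (1.5) (`B15Claim184`), (1.7), (1.8)
(`B15SmallField185.sf17_of_reps` ∕ `sf18_of_reps`) — are separate kernel theorems of the tree.  Value = the row's printed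
induction step as ONE kernel-checked implication with the printed constants; NOT summit progress.
-/

namespace Literature.MathematicalPhysics.QuantumFieldTheory.Balaban1983to89.B15Claim129Step

open Literature.MathematicalPhysics.QuantumFieldTheory.Balaban1983to89
open B15.BasicStep B15Ineq148Proof

/-! ## §1. The sub-case left implicit on p. 187 -/

/-- **The part `Z″_{j+1}∖Z″_j` of the level-`n` domain `Ω^c_{k₀+1}∖Z″_j`** (p. 187, located completion): there the
level-`(n+1)` condition is the (1.49)-line with `i = j`, `|U^{(n+1)}(∂p) − 1| < (1 − β(1 − 2^{−2}))Q·E` (`Q =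
L₀^{2max{0,j−k₀−1}}`, `E = ε_j(L^{k−j}η)²`), and (1.48) with `i = j` (`s = 1`) gives the level-`n` (1.51)-line
`|U^{(n)}(∂p) − 1| < (1 − β½)Q·E`, since `(1 − ¾β)(1 + αβ)Q + αβ ≦ (1 − ½β)Q` for `α ≦ 1/8`, `Q ≧ 1`, `0 ≦ β ≦ 1`.
[cite: Balaban1989LargeFieldI, (1.51) p.187] -/
theorem sf151_of_149_step {dev dev' α β Q E : ℝ} (h148 : Ineq148 dev dev' α β 1 E)
    (h149 : SF149 dev' β (1 / 4) Q E) (hα0 : 0 ≤ α) (hα : α ≤ 1 / 8) (hβ0 : 0 ≤ β) (hβ1 : β ≤ 1)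
    (hQ : 1 ≤ Q) (hE : 0 ≤ E) : SF151 dev β Q E := by
  unfold Ineq148 at h148
  unfold SF149 at h149
  unfold SF151
  have hpos : 0 < 1 + α * β * 1 := by positivity
  have h1 : dev' * (1 + α * β * 1) < (1 - β * (1 - 1 / 4)) * Q * E * (1 + α * β * 1) :=
    mul_lt_mul_of_pos_right h149 hpos
  have hQE : 0 ≤ Q * E := by nlinarith
  -- coefficient comparison: (1 − ¾β)(1 + αβ)Q + αβ ≤ (1 − ½β)Q, multiplied by E ≥ 0
  have hcoef : ((1 - β * (1 - 1 / 4)) * (1 + α * β) * Q + α * β) * E ≤ (1 - β / 2) * Q * E := by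
    apply le_of_sub_nonneg
    have hinner : 0 ≤ (1 - β / 2) * Q - ((1 - β * (1 - 1 / 4)) * (1 + α * β) * Q + α * β) := by
      -- = β·(Q(¼ − α + ¾αβ) − α) ≥ β·(Q·⅛ − ⅛) ≥ 0
      have hQ1 : 0 ≤ Q - 1 := by linarith
      nlinarith [mul_nonneg hβ0 hQ1, mul_nonneg (mul_nonneg hα0 hβ0) hβ0, mul_nonneg hβ0 (by linarith : 0 ≤ 1 / 8 - α),
        mul_nonneg (mul_nonneg hβ0 (by linarith : 0 ≤ 1 / 8 - α)) hQ1]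
    have : (1 - β / 2) * Q * E - ((1 - β * (1 - 1 / 4)) * (1 + α * β) * Q + α * β) * E
        = ((1 - β / 2) * Q - ((1 - β * (1 - 1 / 4)) * (1 + α * β) * Q + α * β)) * E := by ring
    rw [this]
    exact mul_nonneg hinner hE
  have h2 : dev < (1 - β * (1 - 1 / 4)) * Q * E * (1 + α * β * 1) + α * β * 1 * E := by linarith
  have h3 : (1 - β * (1 - 1 / 4)) * Q * E * (1 + α * β * 1) + α * β * 1 * E
      = ((1 - β * (1 - 1 / 4)) * (1 + α * β) * Q + α * β) * E := by ring
  linarith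

/-! ## §2. The inductive step for `χ_k^{(n)}`, assembled over abstract plaquette families -/

/-- **pp. 186–187, the inductive step of the proof of (1.29) for `χ_k^{(n)}`** (*"Thus taking α = 1/8 in (1.48) we satisfy
all the conditions. We have proved that the function χ_k^{(n)} in (1.29) is equal to 1"*), ASSEMBLED.  Data: deviations
`dev p = |U^{(n)}_{k,Z}(∂p) − 1|`, `dev′ p = |U^{(n+1)}_{k,Z}(∂p) − 1|`; level `n ↔ j` (`j + 1 ≦ k`); `ε` the sequence `ε_i`;
`Epow i = (L^{k−i}η)²` with `Epow (j+1) = Epow j / L²`; plaquette families `SZ i` (`h ≦ i < j`: `Z″_{i+1}∖Z″_i`), `SΩ l`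
(`k₀ ≦ l ≦ j`: `Ω_l∖Ω_{l+1}` for `l > k₀`, `Ω^c_{k₀+1}∖Z″_{j+1}` for `l = k₀`), `Sjj` (`Z″_{j+1}∖Z″_j` as part of
`Ω^c_{k₀+1}∖Z″_j`).  Hypotheses: on `SZ i` the level-`(n+1)` (1.49)-line (`t = 2^{−(j+1−i+1)} = s_i/4`, `s_i = (1/2)^{j−i}`)
and (1.48) with gap `j − i`; on `SΩ l` the level-`(n+1)` (1.51)-line (`L₀`-power `(L₀²)^{j−l}`, units `ε_{j+1}Epow(j+1)`) and
(1.48) with `i = j`; on `Sjj` the level-`(n+1)` (1.49)-line with `i = j` and (1.48) with `i = j`; the printed restrictions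
`β₀ ≦ 1/2`, `0 ≦ β ≦ 1/2`, `1 ≦ L₀ < L/2`, `0 ≦ α ≦ 1/8`, the [III] §2 flow input `0 ≦ ε_{j+1} ≦ (1+β₀)ε_j`, signs.
Conclusion: ALL level-`n` lines of (1.24) — (1.49) on every `SZ i` (`t = s_i/2 = 2^{−(j−i+1)}`), (1.51) on every `SΩ l`
(`L₀`-power `(L₀²)^{j−l−1}`) and on `Sjj` (`(L₀²)^{j−k₀−1}`). [cite: Balaban1989LargeFieldI, (1.29) p.183] -/
theorem lines124_step {ι : Type*} (dev dev' : ι → ℝ) {h k₀ j : ℕ} {α β β₀ L L₀ : ℝ} (ε Epow : ℕ → ℝ)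
    (hα0 : 0 ≤ α) (hα : α ≤ 1 / 8) (hβ0 : 0 ≤ β) (hβ : β ≤ 1 / 2) (hβ₀0 : 0 ≤ β₀) (hβ₀ : β₀ ≤ 1 / 2)
    (hL : 0 < L) (hL₀1 : 1 ≤ L₀) (hL₀L : L₀ < L / 2)
    (hε : ∀ i, 0 ≤ ε i) (hEpow : ∀ i, 0 ≤ Epow i) (hflow : ε (j + 1) ≤ (1 + β₀) * ε j)
    (hEsucc : Epow (j + 1) = Epow j / L ^ 2)
    (SZ : ℕ → Set ι) (SΩ : ℕ → Set ι) (Sjj : Set ι)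
    (hZ : ∀ i, h ≤ i → i < j → ∀ p ∈ SZ i,
      SF149 (dev' p) β ((1 / 2 : ℝ) ^ (j - i) / 4) ((L₀ ^ 2) ^ (i - k₀ - 1)) (ε i * Epow i) ∧
      Ineq148 (dev p) (dev' p) α β ((1 / 2 : ℝ) ^ (j - i)) (ε i * Epow i))
    (hΩ : ∀ l, k₀ ≤ l → l ≤ j → ∀ p ∈ SΩ l,
      SF151 (dev' p) β ((L₀ ^ 2) ^ (j - l)) (ε (j + 1) * Epow (j + 1)) ∧
      Ineq148 (dev p) (dev' p) α β 1 (ε j * Epow j))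
    (hjj : ∀ p ∈ Sjj, SF149 (dev' p) β (1 / 4) ((L₀ ^ 2) ^ (j - k₀ - 1)) (ε j * Epow j) ∧
      Ineq148 (dev p) (dev' p) α β 1 (ε j * Epow j)) :
    (∀ i, h ≤ i → i < j → ∀ p ∈ SZ i,
        SF149 (dev p) β ((1 / 2 : ℝ) ^ (j - i) / 2) ((L₀ ^ 2) ^ (i - k₀ - 1)) (ε i * Epow i)) ∧
    (∀ l, k₀ ≤ l → l ≤ j → ∀ p ∈ SΩ l, SF151 (dev p) β ((L₀ ^ 2) ^ (j - l - 1)) (ε j * Epow j)) ∧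
    (∀ p ∈ Sjj, SF151 (dev p) β ((L₀ ^ 2) ^ (j - k₀ - 1)) (ε j * Epow j)) := by
  have hL₀sq : 1 ≤ L₀ ^ 2 := by nlinarith
  have hQ1 : ∀ m : ℕ, (1 : ℝ) ≤ (L₀ ^ 2) ^ m := fun m => one_le_pow₀ hL₀sq
  refine ⟨?_, ?_, ?_⟩
  · -- the (1.49)-lines: b01's `sf149_step` with s = (1/2)^{j−i}
    intro i hi hij p hp
    obtain ⟨h149, h148⟩ := hZ i hi hij p hp
    have hs0 : (0 : ℝ) ≤ (1 / 2 : ℝ) ^ (j - i) := by positivity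
    have hs1 : (1 / 2 : ℝ) ^ (j - i) ≤ 1 := pow_le_one₀ (by norm_num) (by norm_num)
    have hE : 0 ≤ ε i * Epow i := mul_nonneg (hε i) (hEpow i)
    exact sf149_step hα0 hα hβ0 (by linarith) hs0 hs1 (hQ1 _) hE h148 h149
  · -- the (1.51)-lines: `sf151_step` with Q = (L₀²)^{j−l−1}, Q′ = (L₀²)^{j−l} ≤ L₀²·Q
    intro l hl hlj p hp
    obtain ⟨h151, h148⟩ := hΩ l hl hlj p hp
    rw [hEsucc] at h151
    have hQ' : (L₀ ^ 2) ^ (j - l) ≤ L₀ ^ 2 * (L₀ ^ 2) ^ (j - l - 1) := by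
      rcases Nat.eq_zero_or_pos (j - l) with h0 | hpos
      · have h1 : j - l - 1 = 0 := by omega
        rw [h1, h0]; simp only [pow_zero, mul_one]
        exact hL₀sq
      · have e : j - l = (j - l - 1) + 1 := by omega
        rw [e, pow_succ, Nat.add_sub_cancel]
        linarith
    exact sf151_step h148 h151 hβ₀0 hβ₀ hβ0 hβ hα0 (by linarith) (by linarith) hL hL₀L (hQ1 _) hQ'
      (hε j) (hε (j + 1)) hflow (hEpow j)
  · -- the sub-case Z″_{j+1}∖Z″_j ⊂ Ω^c_{k₀+1}∖Z″_j
    intro p hp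
    obtain ⟨h149, h148⟩ := hjj p hp
    exact sf151_of_149_step h148 h149 hα0 hα hβ0 (by linarith) (hQ1 _) (mul_nonneg (hε j) (hEpow j))

/-- **(1.29) for the factor `χ_k^{(n)}`** in the implication form of the typed claim (`B15.BasicStep.Claim129 new old`): if
the new restrictions imply, for every configuration, the level-`(n+1)` lines for `U^{(n+1)}_{k,Z}` together with the
(1.48)-bounds (hypothesis `hchain` — the content of (1.44)–(1.48), `B15Ineq148Proof.ineq148_of_146_147` over the leaves
(1.45)–(1.47)), and those give the level-`n` lines (`lines124_step`), then `Claim129 new old` with `old` := «all level-`n`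
lines of (1.24) hold for `U^{(n)}_{k,Z}`».  Bookkeeping (composition). [cite: Balaban1989LargeFieldI, (1.29) p.183] -/
theorem claim129_step_of_chain {C : Type*} (new bounds old : C → Prop)
    (hchain : ∀ U, new U → bounds U) (hstep : ∀ U, bounds U → old U) : Claim129 new old :=
  fun U hU => hstep U (hchain U hU)

end Literature.MathematicalPhysics.QuantumFieldTheory.Balaban1983to89.B15Claim129Step
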